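import Summits.HodgeConjecture.HodgeConjecture.Theorems.Q8SymplecticPowersTranscendentalOrthogonal
import HarnessLib

/-!
# Route `Q8SymplecticPowers`, crux K1Q — programme M2 (stub S2 `stub_autFreeReductionQ`): the elements of the route's
# quaternionic-unitary centraliser `Uni` PRESERVE the transcendental part `T = Hdg¹(H²X)^{⊥ψ}` and restrict to it

Cell `hodge-nonav`, prover seat `hodge-nonav-prover-Bx` (g20). HELPER FILE for crux K1Q `VeryGeneralQuaternionCommutatorsInHg`
(stmt-HodgeConjecture-24190; `--supports … --as helper`). Sorry-free; axioms standard; no definition.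

For a smooth projective surface `X` with Hodge structure `H` on `V = H²(X; ℚ)`, `N = Hdg¹(H)`, `T = N^{⊥ψ}` (`V = N ⊕ T`), and the trace form
`Q = tr ∘ ∪` (non-degenerate, `N ⊥_Q T` by bricks C-Q3/C-Q4 of K2Q):

* `tr_cup_orthogonal_hodgeClasses_le` — **`N^{⊥Q} ⊆ N^{⊥ψ} = T`** (hence `=`): a `Q`-orthogonal vector has vanishing `N`-component,
  because `Q|_N` is non-degenerate (`V = N ⊕ T`, `N ⊥_Q T`, `Q` non-degenerate on `V`).
* **`apply_mem_transcendental_of_uni`** — a `Q`-isometry `g ∈ GL(V)` fixing `N` pointwise maps `T` into `T`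
  (`Q(g t, n) = Q(g t, g n) = Q(t, n) = 0`); `map_transcendental_eq_of_uni` — onto (`g⁻¹` is of the same kind, `inv_uni`).
* `commutator_apply_eq_of_forall` — the commutator of two automorphisms fixing `N` pointwise fixes `N` pointwise.

Honest scope: linear algebra for S2; nothing here says K1Q or HC is proved.

References: D. Huybrechts, *Lectures on K3 Surfaces*, Ch. 3 Lemma 3.1 and Cor. 3.4; C. Voisin, *Hodge Theory I*, §7.1.2 Lemma 7.26.
-/

set_option linter.dupNamespace false

noncomputable section

open scoped TensorProduct
open CategoryTheory
open Literature.AlgebraicGeometry.Motives Literature.AlgebraicGeometry.HodgeTheory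
open Literature.AlgebraicGeometry.HodgeTheory.BettiUniverse
open Literature.AlgebraicGeometry.Motives.HodgeStructure
open Summit.HodgeConjecture.HodgeConjecture.Theorems.Q8SymplecticPowersTranscendentalOrthogonal

namespace Summit.HodgeConjecture.HodgeConjecture.Theorems.Q8SymplecticPowersUniTranscendental

variable {X : SchemeOver ℂ}

/-- **`Hdg¹^{⊥Q} ⊆ Hdg¹^{⊥ψ}`** for the trace form `Q = tr ∘ ∪` of a smooth projective surface: if `tr(v ∪ n) = 0` for every Hodge class `n`,
then `v ∈ T = Hdg¹^{⊥ψ}` — write `v = n₀ + t`; then `n₀` is `Q`-orthogonal to `Hdg¹` (`t` is, by C-Q4), and `Q` is non-degenerate on `V`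
with `Hdg¹ ⊥_Q T`, so `n₀ = 0`. [cite: Huybrechts2016K3, Ch. 3 Lemma 3.1] [cite: VoisinHodgeI2002, §7.1.2 Lemma 7.26] -/
theorem mem_transcendental_of_forall_tr_cup_eq_zero (hX : IsSmoothProjective 2 X)
    (ψ : Polarization (hodge exists_isReal_hodgeModel_holds hX 2)) {v : bettiCohomology X 2}
    (hv : ∀ n ∈ (hodge exists_isReal_hodgeModel_holds hX 2).hodgeClasses 1, tr hX (2 + 2) (cup X 2 2 v n) = 0) :
    v ∈ ψ.form.orthogonal ((hodge exists_isReal_hodgeModel_holds hX 2).hodgeClasses 1) := by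
  haveI := finite hX 2
  have h11 : (1 : ℤ) + 1 = ((2 : ℕ) : ℤ) := by norm_num
  have hc : IsCompl ((hodge exists_isReal_hodgeModel_holds hX 2).hodgeClasses 1)
      (ψ.form.orthogonal ((hodge exists_isReal_hodgeModel_holds hX 2).hodgeClasses 1)) :=
    ψ.isCompl_hodgeClasses_orthogonal h11
  obtain ⟨n₀, t, hn₀, ht, hsum⟩ := (Submodule.codisjoint_iff_exists_add_eq.1 hc.codisjoint) v
  -- `n₀` is `Q`-orthogonal to everything, hence `0`
  have hn₀0 : n₀ = 0 := by
    refine (nondegenerate_tr_cup hX).1 n₀ fun w ↦ ?_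
    rw [LinearMap.compr₂_apply]
    obtain ⟨m, s, hm, hs, hws⟩ := (Submodule.codisjoint_iff_exists_add_eq.1 hc.codisjoint) w
    rw [← hws, map_add, map_add, tr_cup_eq_zero_of_mem_hodgeClasses_of_mem_orthogonal hX ψ hn₀ hs, add_zero]
    -- `Q(n₀, m) = Q(v, m) - Q(t, m) = 0 - 0`
    have h1 := hv m hm
    rw [← hsum, map_add, LinearMap.add_apply, map_add, tr_cup_eq_zero_of_mem_orthogonal_hodgeClasses hX ψ ht hm, add_zero] at h1
    exact h1
  rw [← hsum, hn₀0, zero_add]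
  exact ht

/-- **A `Q`-isometry fixing the Hodge classes pointwise maps `T = Hdg¹^{⊥ψ}` into itself** (`Q(g t, n) = Q(g t, g n) = Q(t, n) = 0` for
`n ∈ Hdg¹`). This is how the route's `Uni` elements — ℚ-automorphisms of `H²(X; ℚ)` preserving `tr(x ∪ y)` and fixing `Hdg¹` — act on
the transcendental part. [cite: Huybrechts2016K3, Ch. 3 Cor. 3.4] [cite: VoisinHodgeI2002, §7.1.2 Lemma 7.26] -/
theorem apply_mem_transcendental_of_uni (hX : IsSmoothProjective 2 X) (ψ : Polarization (hodge exists_isReal_hodgeModel_holds hX 2))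
    {g : bettiCohomology X 2 ≃ₗ[ℚ] bettiCohomology X 2}
    (hgQ : ∀ x y, tr hX (2 + 2) (cup X 2 2 (g x) (g y)) = tr hX (2 + 2) (cup X 2 2 x y))
    (hgN : ∀ x ∈ (hodge exists_isReal_hodgeModel_holds hX 2).hodgeClasses 1, g x = x) {t : bettiCohomology X 2}
    (ht : t ∈ ψ.form.orthogonal ((hodge exists_isReal_hodgeModel_holds hX 2).hodgeClasses 1)) :
    g t ∈ ψ.form.orthogonal ((hodge exists_isReal_hodgeModel_holds hX 2).hodgeClasses 1) := by
  refine mem_transcendental_of_forall_tr_cup_eq_zero hX ψ fun n hn ↦ ?_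
  conv_lhs => rw [← hgN n hn]
  rw [hgQ]
  exact tr_cup_eq_zero_of_mem_orthogonal_hodgeClasses hX ψ ht hn

/-- **The inverse of a `Uni` element is a `Uni` element** (the four clauses: commutes with `τ^*`, `j^*`, preserves `tr(x ∪ y)`, fixes `Hdg¹`).
[cite: Huybrechts2016K3, Ch. 3 Cor. 3.4] -/
theorem inv_uni (hX : IsSmoothProjective 2 X) (τ j : X ⟶ X) {g : bettiCohomology X 2 ≃ₗ[ℚ] bettiCohomology X 2}
    (hg : (∀ x, g (pull τ 2 x) = pull τ 2 (g x)) ∧ (∀ x, g (pull j 2 x) = pull j 2 (g x)) ∧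
      (∀ x y, tr hX (2 + 2) (cup X 2 2 (g x) (g y)) = tr hX (2 + 2) (cup X 2 2 x y)) ∧
      ∀ x ∈ (hodge exists_isReal_hodgeModel_holds hX 2).hodgeClasses 1, g x = x) :
    (∀ x, g⁻¹ (pull τ 2 x) = pull τ 2 (g⁻¹ x)) ∧ (∀ x, g⁻¹ (pull j 2 x) = pull j 2 (g⁻¹ x)) ∧
      (∀ x y, tr hX (2 + 2) (cup X 2 2 (g⁻¹ x) (g⁻¹ y)) = tr hX (2 + 2) (cup X 2 2 x y)) ∧
      ∀ x ∈ (hodge exists_isReal_hodgeModel_holds hX 2).hodgeClasses 1, g⁻¹ x = x := by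
  obtain ⟨hτ, hj, hQ, hN⟩ := hg
  have hinv : ∀ x, g (g⁻¹ x) = x := fun x ↦ by
    rw [LinearEquiv.coe_inv, LinearEquiv.apply_symm_apply]
  have hinv' : ∀ x, g⁻¹ (g x) = x := fun x ↦ by
    rw [LinearEquiv.coe_inv, LinearEquiv.symm_apply_apply]
  refine ⟨fun x ↦ ?_, fun x ↦ ?_, fun x y ↦ ?_, fun x hx ↦ ?_⟩
  · apply g.injective
    rw [hinv, hτ, hinv]
  · apply g.injective
    rw [hinv, hj, hinv]
  · rw [← hQ (g⁻¹ x) (g⁻¹ y), hinv, hinv]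
  · conv_lhs => rw [← hN x hx]
    rw [hinv']

/-- **`Uni` elements map `T` ONTO `T`**: `T.map g = T` (both `g` and `g⁻¹` map `T` into `T`). [cite: Huybrechts2016K3, Ch. 3 Cor. 3.4] -/
theorem map_transcendental_eq_of_uni (hX : IsSmoothProjective 2 X) (ψ : Polarization (hodge exists_isReal_hodgeModel_holds hX 2))
    {g : bettiCohomology X 2 ≃ₗ[ℚ] bettiCohomology X 2}
    (hgQ : ∀ x y, tr hX (2 + 2) (cup X 2 2 (g x) (g y)) = tr hX (2 + 2) (cup X 2 2 x y))
    (hgN : ∀ x ∈ (hodge exists_isReal_hodgeModel_holds hX 2).hodgeClasses 1, g x = x)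
    (hgQ' : ∀ x y, tr hX (2 + 2) (cup X 2 2 (g⁻¹ x) (g⁻¹ y)) = tr hX (2 + 2) (cup X 2 2 x y))
    (hgN' : ∀ x ∈ (hodge exists_isReal_hodgeModel_holds hX 2).hodgeClasses 1, g⁻¹ x = x) :
    (ψ.form.orthogonal ((hodge exists_isReal_hodgeModel_holds hX 2).hodgeClasses 1)).map (g : bettiCohomology X 2 →ₗ[ℚ] bettiCohomology X 2) =
      ψ.form.orthogonal ((hodge exists_isReal_hodgeModel_holds hX 2).hodgeClasses 1) := by
  refine le_antisymm ?_ fun t ht ↦ ?_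
  · rintro _ ⟨t, ht, rfl⟩
    exact apply_mem_transcendental_of_uni hX ψ hgQ hgN ht
  · refine ⟨g⁻¹ t, apply_mem_transcendental_of_uni hX ψ hgQ' hgN' ht, ?_⟩
    rw [LinearEquiv.coe_coe, LinearEquiv.coe_inv, LinearEquiv.apply_symm_apply]

/-- **The restriction `g|_T ∈ GL(T)`** of a `Uni` element (Mathlib `LinearEquiv.ofSubmodules`) acts as `g` on vectors. [folklore] -/
theorem coe_ofSubmodules_apply {V : Type*} [AddCommGroup V] [Module ℚ V] {T : Submodule ℚ V} (g : V ≃ₗ[ℚ] V)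
    (h : T.map (g : V →ₗ[ℚ] V) = T) (t : T) : ((LinearEquiv.ofSubmodules g T T h) t : V) = g t :=
  rfl

/-- The inverse of the restriction acts as `g⁻¹`. [folklore] -/
theorem coe_ofSubmodules_symm_apply {V : Type*} [AddCommGroup V] [Module ℚ V] {T : Submodule ℚ V} (g : V ≃ₗ[ℚ] V)
    (h : T.map (g : V →ₗ[ℚ] V) = T) (t : T) : (((LinearEquiv.ofSubmodules g T T h).symm t : T) : V) = g⁻¹ t := by
  rw [LinearEquiv.coe_inv]
  rfl

/-- **A commutator of automorphisms fixing `Hdg¹` pointwise fixes `Hdg¹` pointwise.** [folklore] -/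
theorem commutator_apply_eq_of_forall {V : Type*} [AddCommGroup V] [Module ℚ V] {N : Submodule ℚ V} {g h : V ≃ₗ[ℚ] V}
    (hg : ∀ x ∈ N, g x = x) (hh : ∀ x ∈ N, h x = x) (x : V) (hx : x ∈ N) : (g * h * g⁻¹ * h⁻¹) x = x := by
  have hg' : g⁻¹ x = x := by
    rw [LinearEquiv.coe_inv, LinearEquiv.symm_apply_eq]
    exact (hg x hx).symm
  have hh' : h⁻¹ x = x := by
    rw [LinearEquiv.coe_inv, LinearEquiv.symm_apply_eq]
    exact (hh x hx).symm
  rw [LinearEquiv.mul_apply, LinearEquiv.mul_apply, LinearEquiv.mul_apply, hh', hg', hh x hx, hg x hx]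

end Summit.HodgeConjecture.HodgeConjecture.Theorems.Q8SymplecticPowersUniTranscendental

end
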